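import Summits.BirchSwinnertonDyer.Rank1Residual.Additive.X4SharpThreeKimConjectureEndState
import Summits.BirchSwinnertonDyer.Rank1Residual.Additive.TypeGThreeTowerOfSurj
import HarnessLib

/-!
# N11 END STATE modulo the announced Kim 2025 clause, with the EXOTIC clause LOCATED on the
# potentially-good, non-type-(G) rows (cell `b2b-bsdres`, seat additive-p4 gen 17, line V31b; sibling of
# `Additive/X4SharpThreeKimConjectureEndState.lean`, using team n1011-p14's tower-from-surj(3) theorem)

HONEST FRAMING (cell `b2b-bsdres`, run/shared/lean/b2b/bsd-rank1-residual/, verbatim in every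
file): the goal of the cell is to DELETE the COMBINATION-SHAPED residual classes of the
Birch–Swinnerton-Dyer formula for ALL analytic-rank `≤ 1` elliptic curves over `ℚ` — "full BSD
formula for every rank `≤ 1` curve in class `C`" assembled STRICTLY from published theorems — so
that the rank-`≤ 1` remainder becomes exactly the CONSTRUCTION-SHAPED classes, which are TYPED
(missing-input `Prop`s), NOT attempted. This is not "finishing BSD". Sub-cell additive-p4 (X3♯/X4♯
direct): research route on the CONSTRUCTION-SHAPED class X4; the label X4 and the mark of
RESIDUAL-MAP §I N11 are UNCHANGED; nothing is booked. Theorems only (no definition, no named fact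
minted). The one theorem below is CONDITIONAL on the UNREFEREED PREPRINT binder `hK25s` =
`Kim2025.thm11_kimShaLength_of_integralPeriod_OPEN` (flag `Kim2025-preprint`), exactly as its sibling.

## What this file proves

`n11_rankZero_three_iff_kimTamagawaDefect_located_of_kim2025_OPEN`: the sibling's N11 end state
(`n11_rankZero_three_iff_kimTamagawaDefect_of_kim2025_OPEN`: N11 ⟺ Conj 1.10 at `3` on the
admissible-datum TOWER rows ∧ `MissingPPartAt` on the datum-less tower rows ∧ `MissingPPartAt` on
the EXOTIC rows) with clause (iii) RESTRICTED to the rows where the EXOTIC phenomenon can occur at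
all: by n1011-p14's `ClassX4.not_potMult_and_not_typeG_of_not_towerSurj_three`
(`Additive/TypeGThreeTowerOfSurj.lean`; Wuthrich 2014 Lemma 20 now a tree THEOREM in every case,
`Wuthrich2014.lemma20_surjective_threeAdic_of_semistable_holds`) an X4 pair at `3` with `ρ̄_{E,3}`
onto whose 3-adic tower fails is potentially GOOD (`0 ≤ ord₃ j`) and NOT of type (G) — Kodaira
II/III/IV/IV*/III*/II* at `3`, no semistable quadratic twist. So the EXOTIC clause quantifies over
those rows only. Bookkeeping over the sibling; nothing new is assumed; N11's mark UNCHANGED.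

References: Kim 2025 [Kim2025RefinedTNC] Thm. 1.1 (PRE); Kim 2026 [Kim2022StructureSelmer] Conj. 1.10;
Wuthrich 2014 [Wuthrich2014] Lemma 20; Miller 2011 [Miller2011LMS] Def. 1.1.
-/

noncomputable section

open scoped Classical MatrixGroups ModularForm

open CongruenceSubgroup WeierstrassCurve Literature.NumberTheory.EllipticCurves
  Literature.NumberTheory.EllipticCurves.ModularForms
  Literature.NumberTheory.EllipticCurves.Rank1Residual
  Literature.NumberTheory.EllipticCurves.Rank1Residual.Typed

namespace Summit.BirchSwinnertonDyer.Rank1Residual.Additive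

/-- **N11 END STATE modulo the announced Kim 2025 clause, EXOTIC clause located** (CONDITIONAL on
`hK25s`, flag `Kim2025-preprint`; GZK, modularity): "`MissingPPartAt W 3` on every X4 ∧ `r_an = 0` ∧
surj(3) pair" ⟺ (i) Kim's Conjecture 1.10 at `3` on every 3-adic-tower row for every admissible₃
datum (period transfer + `Ω⁺_f`-integral plus symbols) ∧ (ii) `MissingPPartAt W 3` on the tower rows
with no admissible₃ datum ∧ (iii) `MissingPPartAt W 3` on the surj(3) rows with `0 ≤ ord₃ j`, NOT of
type (G), whose tower fails (the only rows where it can fail, by n1011-p14's theorem over Wuthrich's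
Lemma 20). Nothing open assumed as a fact; N11's mark UNCHANGED; nothing booked.
[claim: Kim2025RefinedTNC, status: under-review]
[cite: Kim2025RefinedTNC, Thm. 1.1 ("BSD") (ANNOUNCED, OPEN binder)] [cite: Kim2022StructureSelmer, Conj. 1.10 (PDF p. 8)]
[cite: Wuthrich2014, Lemma 20 (p. 399)] [cite: Miller2011LMS, §1 and Def. 1.1] -/
theorem n11_rankZero_three_iff_kimTamagawaDefect_located_of_kim2025_OPEN
    (hK25s : Kim2025.thm11_kimShaLength_of_integralPeriod_OPEN)
    (hGZK : rank_eq_analyticRank_of_analyticRank_le_one) (hmod : hasEntireLFunction_rat) :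
    (∀ (W : WeierstrassCurve ℚ) [W.IsElliptic] [W.IsGloballyMinimal],
        W.analyticRank = 0 → ClassX4 W 3 → Surj W 3 → MissingPPartAt W 3) ↔
      (∀ (W : WeierstrassCurve ℚ) [W.IsElliptic] [W.IsGloballyMinimal],
          W.analyticRank = 0 → ClassX4 W 3 → (∀ n : ℕ, W.HasSurjectiveModNGaloisRep (3 ^ n : ℕ)) →
          ∀ {N : ℕ} [NeZero N] (D : ModularParametrizationData W N),
          (∃ u : ℚ, ‖(u : ℚ_[3])‖ = 1 ∧ W.realPeriodRat = u * plusPeriod D.f) →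
          (∀ r : ℚ, ratPlusSymbol D.f r ≠ 0 → 0 ≤ padicValRat 3 (ratPlusSymbol D.f r)) →
          X4.KimTamagawaDefectAt W 3 D.f) ∧
      (∀ (W : WeierstrassCurve ℚ) [W.IsElliptic] [W.IsGloballyMinimal],
          W.analyticRank = 0 → ClassX4 W 3 → (∀ n : ℕ, W.HasSurjectiveModNGaloisRep (3 ^ n : ℕ)) →
          (∀ (N : ℕ) [NeZero N] (D : ModularParametrizationData W N),
            (¬ ∃ u : ℚ, ‖(u : ℚ_[3])‖ = 1 ∧ W.realPeriodRat = u * plusPeriod D.f) ∨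
            ¬ ∀ r : ℚ, ratPlusSymbol D.f r ≠ 0 → 0 ≤ padicValRat 3 (ratPlusSymbol D.f r)) →
          MissingPPartAt W 3) ∧
      (∀ (W : WeierstrassCurve ℚ) [W.IsElliptic] [W.IsGloballyMinimal],
          W.analyticRank = 0 → ClassX4 W 3 → Surj W 3 → 0 ≤ padicValRat 3 W.j → ¬ TypeG W 3 →
          ¬ (∀ n : ℕ, W.HasSurjectiveModNGaloisRep (3 ^ n : ℕ)) → MissingPPartAt W 3) := by
  rw [n11_rankZero_three_iff_kimTamagawaDefect_of_kim2025_OPEN hK25s hGZK hmod]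
  refine and_congr_right fun _ ↦ and_congr_right fun _ ↦ ⟨?_, ?_⟩
  · intro h W _ _ hr hX hs _ _ hnot
    exact h W hr hX hs hnot
  · intro h W _ _ hr hX hs hnot
    obtain ⟨hj, hnG⟩ := ClassX4.not_potMult_and_not_typeG_of_not_towerSurj_three hX hs hnot
    exact h W hr hX hs (not_lt.mp hj) hnG hnot

end Summit.BirchSwinnertonDyer.Rank1Residual.Additive

end
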